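import Literature.AlgebraicGeometry.Motives.AbelianVarietyTranslatedTangentVectors
import Literature.AlgebraicGeometry.Motives.Differentials
import HarnessLib

/-!
# The field point of an affine open of an abelian variety (dual-number points on sections)

Topic `Literature/AlgebraicGeometry/Motives`, namespace
`Literature.AlgebraicGeometry.Motives.AbelianVariety`. Theorems and auxiliary definitions (no named
fact; net Literature debt 0). Fourth file of route D′ towards `Mumford1970_cotangentSheaf_abelianVariety_free`
(Görtz–Wedhorn II Prop. 27.15). For an affine open `U = Spec B` of an abelian variety `A/K`
(`B = Γ(A, U)`, structure map `secHom U : K → B` = the one of `Motives/Differentials.constToPresheaf`)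
and a linear form `ℓ` on `𝔪_e/𝔪_e²`, this file builds the `B[ε]`-valued point

  `fieldPt hU ℓ : Spec B[ε] ⟶ A`,  "`x ↦ x · t_ℓ`",

the product in the GROUP `A(B[ε])` (Mathlib `Hom.group` on `Spec B[ε] ⟶ A.X` over `K`; Görtz–Wedhorn II
Rem. 27.1: left translation on `T`-valued points) of the constant lift `Spec B[ε] → Spec B = U ⊆ A` of the
chart point with the `B[ε]`-valued tangent vector `t_ℓ` of `ℓ` (`tangentPtOf`, the tree's `tangentHom`
read along `K → B`; Görtz–Wedhorn II (27.4.6): `Lie(A)(B) ⊆ A(B[ε])`), and proves that it LANDS IN `U`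
(`fieldPt_preimage`: it agrees with the chart point modulo `ε`, and `Spec B → Spec B[ε]` is surjective) —
so that pulling back sections along it is a ring homomorphism `Γ(A, U) → B[ε]` (next file:
`Motives/AbelianVarietyInvariantDerivations`, the invariant derivation `D_ℓ = ε`-part).

* `specOf K s`, `specOfMap` — `Spec R` as a `K`-scheme through an explicit `s : K →+* R` (no `Algebra`
  instance on rings of sections is declared); `pullSec q U h : Γ(A, U) →+* R` for an `R`-point `q`
  landing in `U`, with `pullSec_SpecMap_comp` (naturality in `R`), `pullSec_map` (restriction),
  `pullSec_fromSpec` (the chart pulls back identically), `pullSec_eq_evAtPt` (for local `R`: germ then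
  local homomorphism, Mathlib `Scheme.germ_stalkClosedPointTo`);
* `secHom`, `fromSpec_comp_hom`, `chartPt hU`, `secAug`, `secIncl`, `chartLift hU`;
* `tangentPtOf ℓ s`, `one_specOf_left`, **`specOfMap_fst_comp_tangentPtOf`** (`t_ℓ` reduces to `1`);
* **`fieldPt hU ℓ`**, `secAug_comp_fieldPt` (reduces to the chart point), `specMap_fstHom_surjective`,
  **`fieldPt_preimage`**.

Presearch: [corpus: book:gortz2023 p. 806 Rem. 27.18 (4): `U[ε] := Spec 𝒪_U[T]/(T²)`, (27.4.6); p. 799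
Rem. 27.1 (translations on T-valued points); p. 59 Prop. 17.43] — the dictionary; this affine-chart
packaging is not in print as such; `lit search --hybrid` / `vsearch` («left invariant vector field group
scheme dual numbers sections»): GW II pp. 805–806, Bosch AGCA p. 409; galaxy «invariant derivations|invariant
differential forms|Lie algebra of a group scheme»: no usable hit. Mathlib searched and used:
`IsAffineOpen.fromSpec`/`range_fromSpec`/`fromSpec_app_self`/`fromSpec_preimage_self`/`SpecMap_appLE_fromSpec`/
`fromSpec_top`, `Scheme.Hom.appLE` (+ `appLE_comp_appLE`, `map_appLE`, `appLE_eq_app`), `Scheme.ΓSpecIso_naturality`,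
`Scheme.germ_stalkClosedPointTo`, `Scheme.preimage_eq_top_of_closedPoint_mem`, `PrimeSpectrum.ext`,
`Ideal.IsPrime.mem_of_pow_mem`, `TrivSqZeroExt.inlHom`/`fstHom`/`inr_mul_inr`, `MonObj.comp_mul`/`comp_one`;
in this tree: `ptOfStalkHom`, `SpecMap_comp_ptOfStalkHom`, `ptOfStalkHom_evAt`, `fromSpecStalk_origin_comp_hom`,
`constToPresheaf`, `tangentHomOf` (+ lemmas, `Motives/AbelianVarietyTranslatedTangentVectors`). No `instance`
is declared; `set_option backward.isDefEq.respectTransparency false` as in `Motives/DifferentialsLocallyFreeProofs`.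

## References

* [GortzWedhorn2023] U. Görtz, T. Wedhorn, *Algebraic Geometry II* (2023): Rem. 27.1 (p. 799), Prop. 17.43
  (p. 59), Rem. 27.18 (4) and (27.4.6) (p. 806), Prop. 27.15 (p. 805).
* [GortzWedhorn2020] U. Görtz, T. Wedhorn, *Algebraic Geometry I*, 2nd ed. (2020): (3.4)–(3.5), Exercise 3.18,
  (6.4) Prop. 6.7.
-/

universe u

open CategoryTheory AlgebraicGeometry Opposite TopologicalSpace
open scoped MonObj

noncomputable section

set_option backward.isDefEq.respectTransparency false

namespace Literature.AlgebraicGeometry.Motives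

namespace AbelianVariety

open TrivSqZeroExt AlgPoints

variable {K : Type u} [Field K] {A : AbelianVariety K}

/-! ### `Spec R` as a `K`-scheme through an explicit structure map, and pull-back of sections -/

section SpecOf

variable {R R' R'' : Type u} [CommRing R] [CommRing R'] [CommRing R'']

variable (K) in
/-- `Spec R` as a `K`-scheme through an explicit ring homomorphism `s : K → R` (the tree's
`specOver K R` for `[Algebra K R]` is the case `s = algebraMap K R`, definitionally). [cite: GortzWedhorn2020, (3.4)–(3.5) (schemes over a ring; Hartshorne II Ex. 2.4)] -/
abbrev specOf (s : K →+* R) : SchemeOver K := Over.mk (Spec.map (CommRingCat.ofHom s))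

/-- `Spec` of a ring homomorphism compatible with the structure maps, as a morphism of `K`-schemes. [cite: GortzWedhorn2020, (3.4)–(3.5) (schemes over a ring; Hartshorne II Ex. 2.4)] -/
def specOfMap (s : K →+* R) (s' : K →+* R') (ψ : R →+* R') (h : ψ.comp s = s') :
    specOf K s' ⟶ specOf K s :=
  Over.homMk (Spec.map (CommRingCat.ofHom ψ)) (by
    change Spec.map (CommRingCat.ofHom ψ) ≫ Spec.map (CommRingCat.ofHom s) =
      Spec.map (CommRingCat.ofHom s')
    rw [← Spec.map_comp, ← CommRingCat.ofHom_comp, h])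

/-- Underlying morphism of `specOfMap`. [cite: GortzWedhorn2020, (3.4)–(3.5) (schemes over a ring; Hartshorne II Ex. 2.4)] -/
@[simp]
theorem specOfMap_left (s : K →+* R) (s' : K →+* R') (ψ : R →+* R') (h : ψ.comp s = s') :
    (specOfMap s s' ψ h).left = Spec.map (CommRingCat.ofHom ψ) := rfl

/-- **Pull-back of sections along an `R`-point landing in `U`**: for `q : Spec R → A` with
`q⁻¹U = Spec R`, the ring homomorphism `Γ(A, U) → Γ(Spec R, ⊤) = R`. [cite: GortzWedhorn2020, (3.4)–(3.5) (schemes over a ring; Hartshorne II Ex. 2.4)] -/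
def pullSec {R : CommRingCat.{u}} (q : Spec R ⟶ A.X.left) (U : A.X.left.Opens) (h : ⊤ ≤ q ⁻¹ᵁ U) :
    Γ(A.X.left, U) →+* R :=
  (q.appLE U ⊤ h ≫ (Scheme.ΓSpecIso R).hom).hom

/-- Naturality of `pullSec` in the coefficient ring: pulling back along `Spec S → Spec R → A` is
`ψ ∘` (pulling back along `Spec R → A`). [cite: GortzWedhorn2020, (3.4)–(3.5) (schemes over a ring; Hartshorne II Ex. 2.4)] -/
theorem pullSec_SpecMap_comp {R S : CommRingCat.{u}} (ψ : R ⟶ S) (q : Spec R ⟶ A.X.left)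
    (U : A.X.left.Opens) (h : ⊤ ≤ q ⁻¹ᵁ U) (h' : ⊤ ≤ (Spec.map ψ ≫ q) ⁻¹ᵁ U) :
    pullSec (Spec.map ψ ≫ q) U h' = ψ.hom.comp (pullSec q U h) := by
  have e : (Spec.map ψ ≫ q).appLE U ⊤ h' = q.appLE U ⊤ h ≫ (Spec.map ψ).appTop :=
    (Scheme.Hom.appLE_comp_appLE (Spec.map ψ) q U ⊤ ⊤ h le_top).symm.trans
      (by rw [Scheme.Hom.appTop, Scheme.Hom.app_eq_appLE]; rfl)
  rw [pullSec, pullSec, e, Category.assoc, Scheme.ΓSpecIso_naturality, ← Category.assoc,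
    CommRingCat.hom_comp]

/-- `pullSec` is compatible with restriction of sections. [cite: GortzWedhorn2020, (3.4)–(3.5) (schemes over a ring; Hartshorne II Ex. 2.4)] -/
theorem pullSec_map {R : CommRingCat.{u}} (q : Spec R ⟶ A.X.left) {U V : A.X.left.Opens} (i : V ≤ U)
    (hU : ⊤ ≤ q ⁻¹ᵁ U) (hV : ⊤ ≤ q ⁻¹ᵁ V) (b : Γ(A.X.left, U)) :
    pullSec q V hV (A.X.left.presheaf.map (homOfLE i).op b) = pullSec q U hU b := by
  change ((A.X.left.presheaf.map (homOfLE i).op ≫ q.appLE V ⊤ hV) ≫ (Scheme.ΓSpecIso R).hom) b = _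
  rw [Scheme.Hom.map_appLE]
  rfl

/-- Pulling back along the chart `Spec Γ(A, U) → A` of an affine open `U` is the identity of
`Γ(A, U)`. [cite: GortzWedhorn2020, (3.4)–(3.5) (schemes over a ring; Hartshorne II Ex. 2.4)] -/
theorem pullSec_fromSpec {U : A.X.left.Opens} (hU : IsAffineOpen U)
    (h : ⊤ ≤ hU.fromSpec ⁻¹ᵁ U) (b : Γ(A.X.left, U)) : pullSec hU.fromSpec U h b = b := by
  have e : hU.fromSpec.appLE U ⊤ h = (Scheme.ΓSpecIso Γ(A.X.left, U)).inv := by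
    rw [Scheme.Hom.appLE, hU.fromSpec_app_self, Category.assoc, ← CategoryTheory.Functor.map_comp]
    have : ((eqToHom hU.fromSpec_preimage_self).op ≫ (homOfLE h).op :
        op (⊤ : (Spec Γ(A.X.left, U)).Opens) ⟶ op ⊤) = 𝟙 _ := Subsingleton.elim _ _
    rw [this, CategoryTheory.Functor.map_id, Category.comp_id]
  change ((hU.fromSpec.appLE U ⊤ h) ≫ (Scheme.ΓSpecIso _).hom) b = b
  rw [e, Iso.inv_hom_id]
  rfl

/-- For a point `q : Spec R → A` of a LOCAL ring based at `x ∈ U`, pulling back a section is taking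
its germ at `x` followed by the local homomorphism of `q` (Mathlib `Scheme.germ_stalkClosedPointTo`).
[cite: GortzWedhorn2020, Exercise 3.18 and (6.4) Prop. 6.7 (morphisms Spec R → X, R local, through 𝒪_{X,x})] -/
theorem pullSec_eq_evAtPt {R : CommRingCat.{u}} [IsLocalRing R] (q : Spec R ⟶ A.X.left) {x : A.X.left}
    (hx : q.base (IsLocalRing.closedPoint R) = x) {U : A.X.left.Opens} (hxU : x ∈ U)
    (h : ⊤ ≤ q ⁻¹ᵁ U) (b : Γ(A.X.left, U)) :
    pullSec q U h b = evAtPt x q hx (A.X.left.presheaf.germ U x hxU b) := by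
  subst hx
  have e1 : pullSec q U h b =
      (Scheme.ΓSpecIso R).hom ((Spec R).presheaf.map (homOfLE h).op (q.app U b)) := rfl
  rw [evAtPt, TopCat.Presheaf.stalkCongr_inv, CommRingCat.comp_apply,
    TopCat.Presheaf.germ_stalkSpecializes_apply, ← CommRingCat.comp_apply,
    Scheme.germ_stalkClosedPointTo q U hxU, e1]
  have e3 : (homOfLE h).op =
      ((eqToIso (Scheme.preimage_eq_top_of_closedPoint_mem q hxU).symm).op).hom :=
    Subsingleton.elim _ _
  rw [e3]
  rfl

end SpecOf

/-! ### The chart point, the tangent point and the field point of an affine open -/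

section AffineField

variable {U : A.X.left.Opens} (hU : IsAffineOpen U)

/-- The structure map `K → Γ(A, U)` on the sections over `U` (the one of `Motives/Differentials`,
`constToPresheaf`). [cite: GortzWedhorn2020, (3.4)–(3.5) (schemes over a ring; Hartshorne II Ex. 2.4)] -/
abbrev secHom (U : A.X.left.Opens) : K →+* Γ(A.X.left, U) := ((constToPresheaf A.X).app (op U)).hom

/-- `Spec Γ(A, U) → A → Spec K` is `Spec` of the structure map on sections (Mathlib
`IsAffineOpen.SpecMap_appLE_fromSpec`). [cite: GortzWedhorn2020, (3.4)–(3.5) (schemes over a ring; Hartshorne II Ex. 2.4)] -/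
theorem fromSpec_comp_hom : hU.fromSpec ≫ A.X.hom = Spec.map (CommRingCat.ofHom (secHom U)) := by
  have h1 := IsAffineOpen.SpecMap_appLE_fromSpec A.X.hom (isAffineOpen_top _) hU
    (V := U) (U := ⊤) le_top
  rw [IsAffineOpen.fromSpec_top, Scheme.isoSpec_Spec_inv, ← Spec.map_comp] at h1
  rw [← h1]
  rfl

/-- **The chart point** `Spec Γ(A, U) → A` of an affine open `U`, as a `Γ(A, U)`-valued point of `A`
over `K`. [cite: GortzWedhorn2020, (3.4)–(3.5) (schemes over a ring; Hartshorne II Ex. 2.4)] -/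
def chartPt : specOf K (secHom U) ⟶ A.X := Over.homMk hU.fromSpec (fromSpec_comp_hom hU)

/-- Underlying morphism of `chartPt`. [cite: GortzWedhorn2020, (3.4)–(3.5) (schemes over a ring; Hartshorne II Ex. 2.4)] -/
@[simp]
theorem chartPt_left : (chartPt hU).left = hU.fromSpec := rfl

/-- The structure map of `Γ(A, U)[ε]`. [cite: GortzWedhorn2023, Rem. 27.18 (4) (U[ε] = Spec 𝒪_U[T]/(T²))] -/
abbrev secDualHom (U : A.X.left.Opens) : K →+* DualNumber Γ(A.X.left, U) :=
  (inlHom Γ(A.X.left, U) Γ(A.X.left, U)).comp (secHom U)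

/-- `Spec(ε ↦ 0) : Spec Γ(A,U) → Spec Γ(A,U)[ε]` over `K`. [cite: GortzWedhorn2023, Rem. 27.18 (4) (U[ε] = Spec 𝒪_U[T]/(T²))] -/
def secAug (U : A.X.left.Opens) : specOf K (secHom U) ⟶ specOf K (secDualHom U) :=
  specOfMap _ _ (fstHom Γ(A.X.left, U) Γ(A.X.left, U) Γ(A.X.left, U)).toRingHom (by ext; rfl)

/-- `Spec(incl) : Spec Γ(A,U)[ε] → Spec Γ(A,U)` over `K`. [cite: GortzWedhorn2023, Rem. 27.18 (4) (U[ε] = Spec 𝒪_U[T]/(T²))] -/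
def secIncl (U : A.X.left.Opens) : specOf K (secDualHom U) ⟶ specOf K (secHom U) :=
  specOfMap _ _ (inlHom Γ(A.X.left, U) Γ(A.X.left, U)) rfl

/-- `Spec(ε ↦ 0) ≫ Spec(incl) = 𝟙`. [cite: GortzWedhorn2023, Rem. 27.18 (4) (U[ε] = Spec 𝒪_U[T]/(T²))] -/
theorem secAug_comp_secIncl : secAug U ≫ secIncl U = 𝟙 (specOf K (secHom (A := A) U)) := by
  apply Over.OverMorphism.ext
  rw [Over.comp_left, secAug, secIncl, specOfMap_left, specOfMap_left, Over.id_left]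
  change Spec.map _ ≫ Spec.map _ = 𝟙 (Spec (CommRingCat.of Γ(A.X.left, U)))
  rw [← Spec.map_comp, ← CommRingCat.ofHom_comp]
  have : (fstHom Γ(A.X.left, U) Γ(A.X.left, U) Γ(A.X.left, U)).toRingHom.comp
      (inlHom Γ(A.X.left, U) Γ(A.X.left, U)) = RingHom.id _ := by ext; rfl
  rw [this, CommRingCat.ofHom_id]
  exact Spec.map_id _

/-- **The constant lift** `Spec Γ(A,U)[ε] → Spec Γ(A,U) → A` of the chart point. [cite: GortzWedhorn2023, Rem. 27.18 (4) (U[ε] = Spec 𝒪_U[T]/(T²))] -/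
def chartLift : specOf K (secDualHom U) ⟶ A.X := secIncl U ≫ chartPt hU

variable (ℓ : stalkOrigin A →+ K)
  (hℓs : ∀ (c : K) (a : stalkOrigin A), ℓ (stalkOriginAlgebraMap A c * a) = c * ℓ a)
  (hℓK : ∀ c : K, ℓ (stalkOriginAlgebraMap A c) = 0)
  (hℓ2 : ∀ x ∈ IsLocalRing.maximalIdeal (stalkOrigin A) ^ 2, ℓ x = 0)

/-- **The tangent point over `R`**: the `R[ε]`-point `Spec R[ε] → Spec 𝒪_{A,e} → A` of the linear form
`ℓ` read along `s : K → R` (Görtz–Wedhorn II, (27.4.6): `Lie(A)(R) ⊆ A(R[ε])`). [cite: GortzWedhorn2023, Rem. 27.18 (4) and (27.4.6)] -/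
def tangentPtOf {R : Type u} [CommRing R] (s : K →+* R) : specOf K ((inlHom R R).comp s) ⟶ A.X :=
  Over.homMk (ptOfStalkHom (CommRingCat.ofHom (tangentHomOf s ℓ hℓs hℓK hℓ2))) (by
    change ptOfStalkHom _ ≫ A.X.hom = Spec.map (CommRingCat.ofHom ((inlHom R R).comp s))
    rw [ptOfStalkHom, Category.assoc, fromSpecStalk_origin_comp_hom, ← Spec.map_comp,
      ← tangentHomOf_comp_stalkOriginAlgebraMap s ℓ hℓs hℓK hℓ2]
    rfl)

/-- Underlying morphism of `tangentPtOf`. [cite: GortzWedhorn2023, Rem. 27.18 (4) and (27.4.6)] -/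
@[simp]
theorem tangentPtOf_left {R : Type u} [CommRing R] (s : K →+* R) :
    (tangentPtOf ℓ hℓs hℓK hℓ2 s).left =
      ptOfStalkHom (CommRingCat.ofHom (tangentHomOf s ℓ hℓs hℓK hℓ2)) := rfl

/-- The trivial point over `Spec R` (structure map `s`) is `Spec R → Spec K → A`, i.e. the point of
the local homomorphism `s ∘ ev_e`. [cite: GortzWedhorn2020, Exercise 3.18 and (6.4) Prop. 6.7 (morphisms Spec R → X, R local, through 𝒪_{X,x})] -/
theorem one_specOf_left {R : Type u} [CommRing R] (s : K →+* R) :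
    (1 : specOf K s ⟶ A.X).left = ptOfStalkHom (CommRingCat.ofHom (s.comp (evalOrigin A))) := by
  have h1 : (1 : specOf K s ⟶ A.X) = specOfMap (RingHom.id K) s s (RingHom.comp_id s) ≫
      (1 : specOf K (RingHom.id K) ⟶ A.X) := (MonObj.comp_one _).symm
  have hK : (1 : specOf K (RingHom.id K) ⟶ A.X).left =
      ptOfStalkHom (CommRingCat.ofHom (evalOrigin A)) := by
    have e := ptOfStalkHom_evAt (R := CommRingCat.of K) (1 : specOver K K ⟶ A.X).left (one_left_base _)
    exact e.symm
  rw [h1, Over.comp_left, specOfMap_left, hK]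
  change Spec.map _ ≫ ptOfStalkHom _ = _
  rw [SpecMap_comp_ptOfStalkHom]
  rfl

/-- **The tangent point reduces to the trivial point**: `Spec(ε ↦ 0) ≫ t_{s,ℓ} = 1`. [cite: GortzWedhorn2023, Rem. 27.18 (4) and (27.4.6)] -/
theorem specOfMap_fst_comp_tangentPtOf {R : Type u} [CommRing R] (s : K →+* R) :
    specOfMap ((inlHom R R).comp s) s (fstHom R R R).toRingHom (by ext; rfl) ≫
      tangentPtOf ℓ hℓs hℓK hℓ2 s = 1 := by
  apply Over.OverMorphism.ext
  rw [Over.comp_left, specOfMap_left, tangentPtOf_left, one_specOf_left]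
  change Spec.map _ ≫ ptOfStalkHom _ = _
  have e : CommRingCat.ofHom (tangentHomOf s ℓ hℓs hℓK hℓ2) ≫ CommRingCat.ofHom (fstHom R R R).toRingHom =
      CommRingCat.ofHom (s.comp (evalOrigin A)) := by
    rw [← CommRingCat.ofHom_comp, fstHom_comp_tangentHomOf]
  rw [SpecMap_comp_ptOfStalkHom]
  exact congrArg ptOfStalkHom e

/-- **The field point** of an affine open `U`: the `Γ(A,U)[ε]`-point `x ↦ x · t_ℓ` of `A`, product in the
group `A(Γ(A,U)[ε])` of the constant lift of the chart point with the tangent point (Görtz–Wedhorn II,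
Rem. 27.1: left translation on `T`-valued points; Rem. 27.18 (4)). [cite: GortzWedhorn2023, Rem. 27.1 and Rem. 27.18 (4)] -/
def fieldPt : specOf K (secDualHom U) ⟶ A.X := chartLift hU * tangentPtOf ℓ hℓs hℓK hℓ2 (secHom U)

/-- The field point reduces to the chart point modulo `ε`. [cite: GortzWedhorn2023, Rem. 27.1 and Rem. 27.18 (4)] -/
theorem secAug_comp_fieldPt : secAug U ≫ fieldPt hU ℓ hℓs hℓK hℓ2 = chartPt hU := by
  rw [fieldPt, MonObj.comp_mul, chartLift, ← Category.assoc, secAug_comp_secIncl, Category.id_comp,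
    secAug, specOfMap_fst_comp_tangentPtOf, mul_one]

/-- `Spec(ε ↦ 0) : Spec B → Spec B[ε]` is surjective (every prime contains the square-zero ideal
`εB`). [cite: GortzWedhorn2023, Rem. 27.18 (4) (U[ε] → U is a thickening of order 1)] -/
theorem specMap_fstHom_surjective {B : Type u} [CommRing B] (𝔮 : Spec (CommRingCat.of (DualNumber B))) :
    ∃ 𝔭 : Spec (CommRingCat.of B),
      (Spec.map (CommRingCat.ofHom (fstHom B B B).toRingHom)).base 𝔭 = 𝔮 := by
  refine ⟨(Spec.map (CommRingCat.ofHom (inlHom B B))).base 𝔮, ?_⟩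
  rw [← Scheme.Hom.comp_apply, ← Spec.map_comp]
  apply PrimeSpectrum.ext
  ext z
  change (inl z.fst : DualNumber B) ∈ 𝔮.asIdeal ↔ z ∈ 𝔮.asIdeal
  have hz : z - inl z.fst = inr z.snd := by
    apply TrivSqZeroExt.ext
    · rw [fst_sub, fst_inl, fst_inr, sub_self]
    · rw [snd_sub, snd_inl, snd_inr, sub_zero]
  have hn : z - inl z.fst ∈ 𝔮.asIdeal := by
    apply 𝔮.isPrime.mem_of_pow_mem 2
    rw [hz, pow_two, inr_mul_inr]
    exact 𝔮.asIdeal.zero_mem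
  constructor
  · intro h
    have := 𝔮.asIdeal.add_mem hn h
    rwa [sub_add_cancel] at this
  · intro h
    have := 𝔮.asIdeal.sub_mem h hn
    rwa [sub_sub_cancel] at this

/-- **The field point lands in `U`**: `(fieldPt)⁻¹ U = Spec Γ(A,U)[ε]` (it agrees with the chart point
modulo `ε`, and `Spec B → Spec B[ε]` is surjective). [cite: GortzWedhorn2023, Rem. 27.1 and Rem. 27.18 (4)] -/
theorem fieldPt_preimage : ⊤ ≤ (fieldPt hU ℓ hℓs hℓK hℓ2).left ⁻¹ᵁ U := by
  intro 𝔮 _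
  obtain ⟨𝔭, h𝔭⟩ := specMap_fstHom_surjective (B := Γ(A.X.left, U)) 𝔮
  change (fieldPt hU ℓ hℓs hℓK hℓ2).left.base 𝔮 ∈ U
  have e : (fieldPt hU ℓ hℓs hℓK hℓ2).left.base 𝔮 = (secAug U ≫ fieldPt hU ℓ hℓs hℓK hℓ2).left.base 𝔭 := by
    rw [← h𝔭]
    rfl
  rw [e, secAug_comp_fieldPt, chartPt_left]
  have hmem : hU.fromSpec.base 𝔭 ∈ Set.range hU.fromSpec.base := Set.mem_range_self 𝔭
  rw [hU.range_fromSpec] at hmem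
  exact hmem

end AffineField

end AbelianVariety

end Literature.AlgebraicGeometry.Motives

end
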